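import Summits.QuantumFields.YangMills.Theorems.UnitScaleTiltProp7ChartRealityTwS
import Summits.QuantumFields.YangMills.Theorems.UnitScaleTiltProp7QTwSCentralAdditiveRegPr
import Summits.QuantumFields.YangMills.Theorems.UnitScaleTiltProp7ChartVelocitySU2
import HarnessLib

/-!
# Route `UnitScaleTilt`, crux K1 child «MinimiserStabilityRegPr» (stmt-QuantumFields-19200), skeleton v10, stub `stub_existenceMinimalOrbit` (EX), route (α) — **(R-T5) LETTERS: THE TWO
# REAL-SECTOR FACTS ABOUT THE LINEARISED TWISTED CHART `D := D(log U̿^{twS})(A₁)` AT AN `𝔰𝔲(2)` CHART POINT** — (S1) `D` maps `𝔰𝔲(2)`-valued directions to `𝔰𝔲(2)`-valued coarse fields;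
# (S2) `D` maps central directions `s·1` to central coarse fields — plus the matrix algebra of the θ-averaging (`g(ad Y)` against `star`, the trace and the centre; the splitting
# `M₂(ℂ) = 𝔰𝔲(2) ⊕ i𝔰𝔲(2) ⊕ ℂ·1`).  Consumed by the sibling `UnitScaleTiltProp7TwistedSliceGaugeOntoSU2` (the reality of the (P1) pair of `hSplitD`; ★w5-20520 g6's word
# «w4: (R-T5) θ — GO», 2026-08-28 16:10:57Z).

Cell `ym3-torus`, width seat `ym-ust-20520-w4` (gen 6; reality lineage ✓`Prop7ChartRealityTwS` (g3), ✓`Prop7QTwSReality` (g4), ✓`Prop7GaugeSliceDecomposition(Split)` (g5)).  THEOREMS ONLY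
(0 `def`, 0 `sorry`).  `--supports stmt-QuantumFields-19200 --as helper`, count-neutral.  YM₃ on T³ is a ladder rung (R3), not the Clay problem; nothing here claims the stub, the crux,
d = 4 or the mass gap.

(S1): the chart is `𝔰𝔲(2)`-valued on the real part of its ball `‖A(b)‖ ≤ e·η` (✓`Prop7ChartRealityTwS.logChartTwS_skewHermitian_of_ball` + ✓`dbarTwS_mem_specialUnitaryUnits_of_skewHermitian`,
this seat g3 ∕ ★w3-20520 g4), the segment `A₁ + y` (`y` real, `‖y‖ < e·η − ‖A₁‖`) stays there, and the slopes of an `𝔰𝔲(2)`-valued real curve stay in the CLOSED real subspace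
(✓`fderiv_apply_mem_of_mapsTo_of_ball`, re-based at `A₁` through `y ↦ L(A₁ + y) − L(A₁)`).  (S2): ★★`Prop7SymAvgTwSym.logChartTwS_add_central` AT `A := A₁` (★w5-20520 g5:
`L(A₁ + (iz)·1) = L(A₁) + (iLᵏQ_k z)·1` on `32ℓLᵏ‖z‖ ≤ 1`, under the `1∕8`-rows of the perturbed covariant tower of `e^{A₁}U₀` — DISPLAYED here as `hWl`∕`hT`, gauge-invariant, supplier =
the tower-closeness letter from `RegPr`) and the same closed-subspace trick with the central fields.

WHAT IS PROVED (sorry-free, no definition; ns `…Theorems.Prop7TwistedSliceGaugeOntoSU2`; `M₂ = Matrix (Fin 2) (Fin 2) ℂ`, `L²`-operator norm):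
§1 `star_ad_pow_apply`, ★`star_gSer_ad_apply` (`(g(ad Y)x)⋆ = g(ad Y)(x⋆)`, skew `Y`; general-`x` twin of ✓T2ˢ), `gSer_ad_apply_smul_one` (`g(ad Y)(s·1) = s·1`), `trace_ad_pow_succ_apply`,
★`trace_gSer_ad_apply_eq` (`tr(g(ad Y)x) = tr x`), ★`eq_zero_of_su2_add_I_smul_su2_add_smul_one` (`X + iY + w·1 = 0`, `X, Y ∈ 𝔰𝔲(2)` ⇒ all zero);
§2 (at `U₀ ∈ 𝔘_k(ε₀)`, `10⁹L²e ≤ 1`, `10¹²L³ε₀ ≤ 1`, `‖A₁‖ < e·η`) `hasFDerivAt_logChartTwS_at`, `hasFDerivAt_logChartTwS_translate`, ★★`fderiv_logChartTwS_su2` (S1),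
★★`fderiv_logChartTwS_central` (S2).
HONEST SCOPE.  Closed-subspace arguments and algebra over landed theorems; the `1∕8` tower rows at `A₁` are hypotheses; nothing of `hSplitD`, EX, the crux, N06(d = 3) or the gap is proved.

References: T. Bałaban, CMP **102** (1985) 277–309 [Balaban1985Variational] ((51) p.286); CMP **99** (1985) 389–434 [Balaban1985BackgroundPropagators] ((3.13)–(3.15), (3.19) p.393);
CMP **98** (1985) 17–51 [Balaban1985Averaging] ((29), (32)–(34) pp.22–23, (125)–(127) p.36).
-/

set_option autoImplicit false

noncomputable section

open scoped BigOperators Matrix Matrix.Norms.L2Operator Topology Nat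
open Filter Metric Set NormedSpace

namespace Summit.QuantumFields.YangMills.Theorems.Prop7TwistedSliceGaugeOntoSU2

open Literature.Analysis.Calculus.ExpDifferential (ad ad_apply gSer gSer_ad_apply summable_gSer_term')
open Literature.MathematicalPhysics.QuantumFieldTheory.Balaban1983to89
open Literature.MathematicalPhysics.QuantumFieldTheory.Balaban1983to89.T3ContinuumYM3Torus
open T4Continuum BlockAveraging ExpMeanLog LatticeFieldCalculus
open T3LevelShift (bondShift)
open T3PrintedRegularOrbits (sites_eq)
open T3PrintedRegularMinimiser (RegPr)
open T3SectALandauChart (eta eta_pos bgUnits)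
open B7Prop1Explicit (expUnit)
open B7Prop2SpecialUnitary (specialUnitaryUnits)
open Summit.QuantumFields.YangMills.Theorems.Prop8Chart (loopHolU emlIterU)
open Summit.QuantumFields.YangMills.Theorems.Prop7SymAvgTwSym (tstairU dbarCovIterU dbarTwS logChartTwS logChartTwS_add_central norm_dbarTwS_sub_one_le_eighth_of_regPr)
open Summit.QuantumFields.YangMills.Theorems.Prop7CmapTwSymInputs (analyticOnNhd_logChartTwS)
open Summit.QuantumFields.YangMills.Theorems.Prop7ChartRealityTwS (fderiv_apply_mem_of_mapsTo_of_ball logChartTwS_skewHermitian_of_ball dbarTwS_mem_specialUnitaryUnits_of_skewHermitian)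

/-! ## §1 Matrix algebra: `g(ad Y)` against `star`, the trace and the centre; the `𝔰𝔲(2) ⊕ i𝔰𝔲(2) ⊕ ℂ·1` decomposition -/

section Algebra

variable {𝔸 : Type*} [NormedRing 𝔸] [NormedAlgebra ℂ 𝔸] [CompleteSpace 𝔸] [StarRing 𝔸] [ContinuousStar 𝔸] [StarModule ℂ 𝔸]

omit [CompleteSpace 𝔸] [ContinuousStar 𝔸] [StarModule ℂ 𝔸] in
/-- `((ad Y)ᵐ x)⋆ = (ad Y)ᵐ(x⋆)` for skew-Hermitian `Y` (`(Yx − xY)⋆ = x⋆Y⋆ − Y⋆x⋆ = Y x⋆ − x⋆ Y` up to sign bookkeeping). [cite: Balaban1985Averaging, (29) p.22, (32)-(34) pp.22-23] -/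
theorem star_ad_pow_apply {Y : 𝔸} (hY : star Y = -Y) (x : 𝔸) (m : ℕ) :
    star ((ad ℂ Y ^ m) x) = (ad ℂ Y ^ m) (star x) := by
  induction m with
  | zero => simp
  | succ m ih =>
    rw [pow_succ']
    show star (ad ℂ Y ((ad ℂ Y ^ m) x)) = ad ℂ Y ((ad ℂ Y ^ m) (star x))
    rw [ad_apply, ad_apply, star_sub, star_mul, star_mul, ih, hY]
    noncomm_ring

/-- ★ **THE VELOCITY MAP COMMUTES WITH `star` AT A SKEW-HERMITIAN EXPONENT**: `(g(ad Y)x)⋆ = g(ad Y)(x⋆)` (real coefficients `(−1)ᵐ∕(m+1)!`, `tsum_star`) — the general-`x` twin of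
✓`Prop7ChartVelocitySU2.star_gSer_ad_apply_of_skew`; the (θ-M) letter of the θ-averaging. [cite: Balaban1985Averaging, (32)-(34) pp.22-23] -/
theorem star_gSer_ad_apply {Y : 𝔸} (hY : star Y = -Y) (x : 𝔸) :
    star (gSer ℂ (ad ℂ Y) x) = gSer ℂ (ad ℂ Y) (star x) := by
  rw [gSer_ad_apply, gSer_ad_apply, tsum_star]
  refine tsum_congr fun m => ?_
  rw [star_smul, star_ad_pow_apply hY x m]
  congr 1
  rw [Complex.star_def, map_mul, map_pow, map_neg, map_one, map_inv₀, map_natCast]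

omit [StarRing 𝔸] [ContinuousStar 𝔸] [StarModule ℂ 𝔸] in
/-- **THE VELOCITY MAP FIXES THE CENTRE**: `g(ad Y)(s·1) = s·1` (`(ad Y)1 = 0`, only the `m = 0` term survives). [cite: Balaban1985Averaging, (32)-(34) pp.22-23] -/
theorem gSer_ad_apply_smul_one (Y : 𝔸) (s : ℂ) : gSer ℂ (ad ℂ Y) (s • (1 : 𝔸)) = s • (1 : 𝔸) := by
  rw [map_smul, gSer_ad_apply]
  congr 1
  have hs := (ContinuousLinearMap.apply ℂ 𝔸 (1 : 𝔸)).summable (summable_gSer_term' (𝕂 := ℂ) (ad ℂ Y))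
  have hs' : Summable fun m : ℕ => ((-1) ^ m * ((m + 1)! : ℂ)⁻¹) • (ad ℂ Y ^ m) (1 : 𝔸) := by
    refine hs.congr fun m => ?_
    simp only [ContinuousLinearMap.apply_apply, smul_apply]
  rw [hs'.tsum_eq_zero_add]
  have had1 : ∀ m : ℕ, (ad ℂ Y ^ (m + 1)) (1 : 𝔸) = 0 := fun m => by
    rw [pow_succ]
    change (ad ℂ Y ^ m) (ad ℂ Y (1 : 𝔸)) = 0
    rw [ad_apply, mul_one, one_mul, sub_self, map_zero]
  have h0 : ∀ m : ℕ, ((-1 : ℂ) ^ (m + 1) * (((m + 1 + 1)! : ℕ) : ℂ)⁻¹) • (ad ℂ Y ^ (m + 1)) (1 : 𝔸) = 0 := fun m => by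
    rw [had1, smul_zero]
  simp only [h0, tsum_zero, add_zero, pow_zero, one_mul, zero_add, Nat.factorial_one, Nat.cast_one, inv_one, one_smul, one_apply_eq_self]

end Algebra

section Matrix2

/-- commutators are traceless: `tr((ad Y)ᵐ⁺¹ x) = 0`. [folklore] -/
theorem trace_ad_pow_succ_apply {N : ℕ} (Y x : Matrix (Fin N) (Fin N) ℂ) (m : ℕ) :
    ((ad ℂ Y ^ (m + 1)) x).trace = 0 := by
  rw [pow_succ']
  show (ad ℂ Y ((ad ℂ Y ^ m) x)).trace = 0
  rw [ad_apply, Matrix.trace_sub, Matrix.trace_mul_comm, sub_self]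

/-- ★ **THE VELOCITY MAP PRESERVES THE TRACE**: `tr(g(ad Y)x) = tr x` (the trace through the `tsum`; all commutator terms vanish) — the general-`x` twin of
✓`Prop7ChartVelocitySU2.trace_gSer_ad_apply`. [cite: Balaban1985Averaging, (32)-(34) pp.22-23] -/
theorem trace_gSer_ad_apply_eq {N : ℕ} (Y x : Matrix (Fin N) (Fin N) ℂ) :
    (gSer ℂ (ad ℂ Y) x).trace = x.trace := by
  rw [gSer_ad_apply]
  have hs : Summable fun m : ℕ => ((-1) ^ m * ((m + 1)! : ℂ)⁻¹) • (ad ℂ Y ^ m) x := by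
    have h1 := (ContinuousLinearMap.apply ℂ (Matrix (Fin N) (Fin N) ℂ) x).summable (summable_gSer_term' (𝕂 := ℂ) (ad ℂ Y))
    refine h1.congr fun m => ?_
    simp only [ContinuousLinearMap.apply_apply, smul_apply]
  set τ : Matrix (Fin N) (Fin N) ℂ →L[ℂ] ℂ := LinearMap.toContinuousLinearMap (Matrix.traceLinearMap (Fin N) ℂ ℂ) with hτ
  have hτapp : ∀ M : Matrix (Fin N) (Fin N) ℂ, τ M = M.trace := fun M => rfl
  rw [← hτapp, τ.map_tsum hs, hs.mapL τ |>.tsum_eq_zero_add]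
  have h0 : ∀ m : ℕ, τ (((-1) ^ (m + 1) * ((m + 1 + 1)! : ℂ)⁻¹) • (ad ℂ Y ^ (m + 1)) x) = 0 := fun m => by
    rw [map_smul, hτapp, trace_ad_pow_succ_apply Y x m, smul_zero]
  have h1 : τ (((-1) ^ 0 * ((0 + 1)! : ℂ)⁻¹) • (ad ℂ Y ^ 0) x) = x.trace := by
    rw [hτapp, pow_zero, one_mul, zero_add, Nat.factorial_one, Nat.cast_one, inv_one, one_smul, pow_zero, one_apply_eq_self]
  rw [h1]
  simp only [h0, tsum_zero, add_zero]

/-- ★ **`M₂(ℂ) = 𝔰𝔲(2) ⊕ i·𝔰𝔲(2) ⊕ ℂ·1` ON A VANISHING SUM**: if `X + iY + w·1 = 0` with `X, Y` skew-Hermitian traceless then `X = 0`, `Y = 0`, `w = 0` (trace kills `w`; then `X = −iY` is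
both skew and Hermitian). [folklore] -/
theorem eq_zero_of_su2_add_I_smul_su2_add_smul_one {X Y : Matrix (Fin 2) (Fin 2) ℂ} {w : ℂ}
    (hX : star X = -X ∧ X.trace = 0) (hY : star Y = -Y ∧ Y.trace = 0) (h : X + Complex.I • Y + w • (1 : Matrix (Fin 2) (Fin 2) ℂ) = 0) :
    X = 0 ∧ Y = 0 ∧ w = 0 := by
  -- the trace kills `X` and `Y`
  have hw : w = 0 := by
    have ht := congrArg Matrix.trace h
    rw [Matrix.trace_add, Matrix.trace_add, Matrix.trace_smul, Matrix.trace_smul, hX.2, hY.2, Matrix.trace_one, Matrix.trace_zero,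
      smul_zero, zero_add, zero_add, Fintype.card_fin] at ht
    have : w * 2 = 0 := by simpa using ht
    simpa using this
  rw [hw, zero_smul, add_zero] at h
  -- `X = −iY` is both skew and Hermitian, hence zero
  have hXY : X = -(Complex.I • Y) := eq_neg_of_add_eq_zero_left h
  have h1 : star X = X := by
    rw [hXY, star_neg, star_smul, hY.1, Complex.star_def, Complex.conj_I, neg_smul_neg]
  have hX0 : X = 0 := by
    have h2 : (2 : ℂ) • X = 0 := by
      rw [two_smul]
      nth_rewrite 1 [← h1]
      rw [hX.1, neg_add_cancel]
    exact (smul_eq_zero.1 h2).resolve_left two_ne_zero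
  refine ⟨hX0, ?_, hw⟩
  rw [hX0, zero_add] at h
  exact (smul_eq_zero.1 h).resolve_left Complex.I_ne_zero

end Matrix2

/-! ## §2 The two real-sector facts about `D := fderiv ℂ (logChartTwS U₀) A₁` at an `𝔰𝔲(2)` chart point -/

section Structure

variable (F : T3Family) {n K : ℕ} (h : n ≤ K)

/-- the twisted log-chart is differentiable at every `A₁` of the ball `‖A₁‖ < e·η` (✓`analyticOnNhd_logChartTwS`). [cite: Balaban1985BackgroundPropagators, (3.13)-(3.14) p.393] -/
theorem hasFDerivAt_logChartTwS_at {ε₀ e : ℝ} (hε₀ : 0 < ε₀) (he : 0 < e) (hWe : 10 ^ 9 * (F.L : ℝ) ^ 2 * e ≤ 1) (hWε : 10 ^ 12 * (F.L : ℝ) ^ 3 * ε₀ ≤ 1)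
    (U₀ : GaugeField (F.P K) 0 (Matrix.specialUnitaryGroup (Fin 2) ℂ)) (hreg : RegPr F n K ε₀ U₀)
    {A₁ : PBond (F.P K) 0 → Matrix (Fin 2) (Fin 2) ℂ} (hA₁ : ‖A₁‖ < e * eta F n K) :
    HasFDerivAt (logChartTwS F n K h U₀) (fderiv ℂ (logChartTwS F n K h U₀) A₁) A₁ :=
  ((analyticOnNhd_logChartTwS F h hε₀ he hWe hWε U₀ hreg) A₁ (mem_ball_zero_iff.2 hA₁)).differentiableAt.hasFDerivAt

/-- the re-based chart `y ↦ L(A₁ + y) − L(A₁)` has derivative `D = DL(A₁)` at `0` and vanishes there (the form ✓`fderiv_apply_mem_of_mapsTo_of_ball` consumes).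
[cite: Balaban1985BackgroundPropagators, (3.13)-(3.14) p.393] -/
theorem hasFDerivAt_logChartTwS_translate {ε₀ e : ℝ} (hε₀ : 0 < ε₀) (he : 0 < e) (hWe : 10 ^ 9 * (F.L : ℝ) ^ 2 * e ≤ 1) (hWε : 10 ^ 12 * (F.L : ℝ) ^ 3 * ε₀ ≤ 1)
    (U₀ : GaugeField (F.P K) 0 (Matrix.specialUnitaryGroup (Fin 2) ℂ)) (hreg : RegPr F n K ε₀ U₀)
    {A₁ : PBond (F.P K) 0 → Matrix (Fin 2) (Fin 2) ℂ} (hA₁ : ‖A₁‖ < e * eta F n K) :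
    HasFDerivAt (fun y : PBond (F.P K) 0 → Matrix (Fin 2) (Fin 2) ℂ => logChartTwS F n K h U₀ (A₁ + y) - logChartTwS F n K h U₀ A₁)
      (fderiv ℂ (logChartTwS F n K h U₀) A₁) 0 := by
  have hD := hasFDerivAt_logChartTwS_at F h hε₀ he hWe hWε U₀ hreg hA₁
  have ht : HasFDerivAt (fun y : PBond (F.P K) 0 → Matrix (Fin 2) (Fin 2) ℂ => A₁ + y) (ContinuousLinearMap.id ℂ _) 0 :=
    (hasFDerivAt_id (0 : PBond (F.P K) 0 → Matrix (Fin 2) (Fin 2) ℂ)).const_add A₁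
  have hD' : HasFDerivAt (logChartTwS F n K h U₀) (fderiv ℂ (logChartTwS F n K h U₀) A₁) (A₁ + 0) := by rwa [add_zero]
  have hc := (hD'.comp (0 : PBond (F.P K) 0 → Matrix (Fin 2) (Fin 2) ℂ) ht).sub_const (logChartTwS F n K h U₀ A₁)
  rwa [ContinuousLinearMap.comp_id] at hc

/-- ★★ **(S1) THE LINEARISED TWISTED CHART AT AN `𝔰𝔲(2)` CHART POINT MAPS `𝔰𝔲(2)` DIRECTIONS TO `𝔰𝔲(2)` COARSE FIELDS**: at `U₀ ∈ 𝔘_k(ε₀)` (`10⁹L²e ≤ 1`, `10¹²L³ε₀ ≤ 1`), for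
`A₁` skew-Hermitian traceless with `‖A₁‖ < e·η` and every skew-Hermitian traceless `α`: `(DL(A₁)α)(c)⋆ = −(DL(A₁)α)(c)` and `tr = 0` at every comparison bond.  The chart is
`𝔰𝔲(2)`-valued on the real part of its ball (✓`logChartTwS_skewHermitian_of_ball` with ✓`dbarTwS_mem_specialUnitaryUnits_of_skewHermitian`), the segment `A₁ + y`, `‖y‖ < e·η − ‖A₁‖`,
stays there, and `𝔰𝔲(2)`-valued coarse fields are a closed real subspace (✓`fderiv_apply_mem_of_mapsTo_of_ball`). [cite: Balaban1985Variational, (51) p.286; Balaban1985BackgroundPropagators, (3.13)-(3.14) p.393] -/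
theorem fderiv_logChartTwS_su2 {ε₀ e : ℝ} (hε₀ : 0 < ε₀) (he : 0 < e) (hWe : 10 ^ 9 * (F.L : ℝ) ^ 2 * e ≤ 1) (hWε : 10 ^ 12 * (F.L : ℝ) ^ 3 * ε₀ ≤ 1)
    (U₀ : GaugeField (F.P K) 0 (Matrix.specialUnitaryGroup (Fin 2) ℂ)) (hreg : RegPr F n K ε₀ U₀)
    {A₁ : PBond (F.P K) 0 → Matrix (Fin 2) (Fin 2) ℂ} (hA₁ : ‖A₁‖ < e * eta F n K) (hA₁R : ∀ b, star (A₁ b) = -A₁ b ∧ (A₁ b).trace = 0)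
    (α : PBond (F.P K) 0 → Matrix (Fin 2) (Fin 2) ℂ) (hα : ∀ b, star (α b) = -α b ∧ (α b).trace = 0) (c : PBond (F.P n) 0) :
    star (fderiv ℂ (logChartTwS F n K h U₀) A₁ α c) = -fderiv ℂ (logChartTwS F n K h U₀) A₁ α c ∧ (fderiv ℂ (logChartTwS F n K h U₀) A₁ α c).trace = 0 := by
  -- the real spaces: `𝔰𝔲(2)`-valued fine fields and coarse fields
  let S : Submodule ℝ (PBond (F.P K) 0 → Matrix (Fin 2) (Fin 2) ℂ) :=
    { carrier := {A | ∀ b, star (A b) = -A b ∧ (A b).trace = 0}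
      add_mem' := fun {A B} hA hB b => by
        refine ⟨?_, ?_⟩
        · rw [Pi.add_apply, star_add, (hA b).1, (hB b).1, neg_add]
        · rw [Pi.add_apply, Matrix.trace_add, (hA b).2, (hB b).2, add_zero]
      zero_mem' := fun b => by simp
      smul_mem' := fun r A hA b => by
        refine ⟨?_, ?_⟩
        · rw [Pi.smul_apply, star_smul, star_trivial, (hA b).1, smul_neg]
        · rw [Pi.smul_apply, Matrix.trace_smul, (hA b).2, smul_zero] }
  let S' : Submodule ℝ (PBond (F.P n) 0 → Matrix (Fin 2) (Fin 2) ℂ) :=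
    { carrier := {Y | ∀ c, star (Y c) = -Y c ∧ (Y c).trace = 0}
      add_mem' := fun {A B} hA hB c => by
        refine ⟨?_, ?_⟩
        · rw [Pi.add_apply, star_add, (hA c).1, (hB c).1, neg_add]
        · rw [Pi.add_apply, Matrix.trace_add, (hA c).2, (hB c).2, add_zero]
      zero_mem' := fun c => by simp
      smul_mem' := fun r A hA c => by
        refine ⟨?_, ?_⟩
        · rw [Pi.smul_apply, star_smul, star_trivial, (hA c).1, smul_neg]
        · rw [Pi.smul_apply, Matrix.trace_smul, (hA c).2, smul_zero] }
  have hS'c : IsClosed (S' : Set (PBond (F.P n) 0 → Matrix (Fin 2) (Fin 2) ℂ)) := by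
    have hset : (S' : Set (PBond (F.P n) 0 → Matrix (Fin 2) (Fin 2) ℂ)) =
        ⋂ c : PBond (F.P n) 0, (fun Y : PBond (F.P n) 0 → Matrix (Fin 2) (Fin 2) ℂ => Y c) ⁻¹' ({X | star X = -X} ∩ {X | X.trace = 0}) := by
      ext Y
      simp only [Set.mem_iInter, Set.mem_preimage, Set.mem_inter_iff, Set.mem_setOf_eq]
      exact Iff.rfl
    rw [hset]
    refine isClosed_iInter fun c => IsClosed.preimage (continuous_apply c) ?_
    exact (isClosed_eq continuous_star continuous_neg).inter
      (isClosed_eq ((Matrix.traceLinearMap (Fin 2) ℂ ℂ).continuous_of_finiteDimensional) continuous_const)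
  -- the translated chart sends `S ∩ B(0, ρ)` into `S′`, `ρ := e·η − ‖A₁‖`
  have hρ : 0 < e * eta F n K - ‖A₁‖ := sub_pos.2 hA₁
  have hmaps : ∀ y ∈ S, ‖y‖ < e * eta F n K - ‖A₁‖ →
      (fun y : PBond (F.P K) 0 → Matrix (Fin 2) (Fin 2) ℂ => logChartTwS F n K h U₀ (A₁ + y) - logChartTwS F n K h U₀ A₁) y ∈ S' := by
    intro y hy hyρ c'
    have hAy : ∀ b, star ((A₁ + y) b) = -(A₁ + y) b ∧ ((A₁ + y) b).trace = 0 := fun b => by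
      refine ⟨?_, ?_⟩
      · rw [Pi.add_apply, star_add, (hA₁R b).1, (hy b).1, neg_add]
      · rw [Pi.add_apply, Matrix.trace_add, (hA₁R b).2, (hy b).2, add_zero]
    have hAye : ∀ b, ‖(A₁ + y) b‖ ≤ e * eta F n K := fun b =>
      (norm_le_pi_norm (A₁ + y) b).trans ((norm_add_le _ _).trans (by linarith))
    have hA₁e : ∀ b, ‖A₁ b‖ ≤ e * eta F n K := fun b => (norm_le_pi_norm A₁ b).trans hA₁.le
    have h1 := logChartTwS_skewHermitian_of_ball F h hε₀ he.le hWe hWε U₀ hreg (A₁ + y) hAye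
      (fun c => dbarTwS_mem_specialUnitaryUnits_of_skewHermitian F h hε₀ he.le hWe hWε U₀ hreg (A₁ + y) hAy hAye c) c'
    have h2 := logChartTwS_skewHermitian_of_ball F h hε₀ he.le hWe hWε U₀ hreg A₁ hA₁e
      (fun c => dbarTwS_mem_specialUnitaryUnits_of_skewHermitian F h hε₀ he.le hWe hWε U₀ hreg A₁ hA₁R hA₁e c) c'
    show star ((logChartTwS F n K h U₀ (A₁ + y) - logChartTwS F n K h U₀ A₁) c') = -(logChartTwS F n K h U₀ (A₁ + y) - logChartTwS F n K h U₀ A₁) c' ∧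
      ((logChartTwS F n K h U₀ (A₁ + y) - logChartTwS F n K h U₀ A₁) c').trace = 0
    refine ⟨?_, ?_⟩
    · rw [Pi.sub_apply, star_sub, h1.1, h2.1, neg_sub_neg, neg_sub]
    · rw [Pi.sub_apply, Matrix.trace_sub, h1.2, h2.2, sub_zero]
  have key := fderiv_apply_mem_of_mapsTo_of_ball (hasFDerivAt_logChartTwS_translate F h hε₀ he hWe hWε U₀ hreg hA₁)
    (by simp) S S' hS'c hρ hmaps (v := α) hα
  exact key c

/-- ★★ **(S2) THE LINEARISED TWISTED CHART MAPS CENTRAL DIRECTIONS TO CENTRAL COARSE FIELDS**: at `U₀ ∈ 𝔘_k(ε₀)`, `‖A₁‖ < e·η`, under the DISPLAYED `1∕8`-rows of the perturbed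
covariant tower of `e^{A₁}U₀` (`hWl`: loops, `hT`: twisted stairs, `j < k` — exactly the rows of ★★`Prop7SymAvgTwSym.logChartTwS_add_central` at `A := A₁`), for every scalar bond field `s`:
`(DL(A₁)(s·1))(c) = (½·tr(DL(A₁)(s·1))(c))·1`.  Central additivity `L(A₁ + (iz)·1) = L(A₁) + (iLᵏQ_k z)·1` on the ball `32ℓLᵏ‖y‖ ≤ 1` (`‖U̿^{twS}(A₁) − 1‖ ≤ 1∕8` by
✓`norm_dbarTwS_sub_one_le_eighth_of_regPr`, `e ≤ (10⁹L²)⁻¹`), and central coarse fields are a closed real subspace. [cite: Balaban1985BackgroundPropagators, (3.14)-(3.15) p.393; Balaban1985Averaging, (125)-(127) p.36] -/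
theorem fderiv_logChartTwS_central {ε₀ e : ℝ} (hε₀ : 0 < ε₀) (he : 0 < e) (hWe : 10 ^ 9 * (F.L : ℝ) ^ 2 * e ≤ 1) (hWε : 10 ^ 12 * (F.L : ℝ) ^ 3 * ε₀ ≤ 1)
    (U₀ : GaugeField (F.P K) 0 (Matrix.specialUnitaryGroup (Fin 2) ℂ)) (hreg : RegPr F n K ε₀ U₀)
    {A₁ : PBond (F.P K) 0 → Matrix (Fin 2) (Fin 2) ℂ} (hA₁ : ‖A₁‖ < e * eta F n K)
    (hWl : ∀ j, j < K - n → ∀ (c : PBond (F.P K) (j + 1)) (i : Idx (F.P K)),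
      ‖((loopHolU (dbarCovIterU j (bgUnits F K U₀) (fun b => expUnit (A₁ b) * bgUnits F K U₀ b)) c i : (Matrix (Fin 2) (Fin 2) ℂ)ˣ) : Matrix (Fin 2) (Fin 2) ℂ) - 1‖ ≤ 1 / 8)
    (hT : ∀ j, j < K - n → ∀ (y : Site (F.P K) (j + 1)) (i : Idx (F.P K)),
      ‖((tstairU (emlIterU j (bgUnits F K U₀)) (dbarCovIterU j (bgUnits F K U₀) (fun b => expUnit (A₁ b) * bgUnits F K U₀ b)) y i : (Matrix (Fin 2) (Fin 2) ℂ)ˣ) :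
        Matrix (Fin 2) (Fin 2) ℂ) - 1‖ ≤ 1 / 8)
    (s : PBond (F.P K) 0 → ℂ) (c : PBond (F.P n) 0) :
    fderiv ℂ (logChartTwS F n K h U₀) A₁ (fun b => s b • (1 : Matrix (Fin 2) (Fin 2) ℂ)) c =
      ((2 : ℂ)⁻¹ * (fderiv ℂ (logChartTwS F n K h U₀) A₁ (fun b => s b • (1 : Matrix (Fin 2) (Fin 2) ℂ)) c).trace) • (1 : Matrix (Fin 2) (Fin 2) ℂ) := by
  -- the central fine fields and the central coarse fields
  let Z : Submodule ℝ (PBond (F.P K) 0 → Matrix (Fin 2) (Fin 2) ℂ) :=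
    { carrier := {A | ∀ b, A b = ((2 : ℂ)⁻¹ * (A b).trace) • (1 : Matrix (Fin 2) (Fin 2) ℂ)}
      add_mem' := fun {A B} hA hB b => by
        rw [Pi.add_apply, Matrix.trace_add, mul_add, add_smul, ← hA b, ← hB b]
      zero_mem' := fun b => by simp
      smul_mem' := fun r A hA b => by
        rw [Pi.smul_apply, Matrix.trace_smul, RCLike.real_smul_eq_coe_smul (K := ℂ) r (A b), RCLike.real_smul_eq_coe_smul (K := ℂ) r (A b).trace]
        conv_lhs => rw [hA b]
        rw [smul_smul, smul_eq_mul, mul_left_comm] }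
  let Z' : Submodule ℝ (PBond (F.P n) 0 → Matrix (Fin 2) (Fin 2) ℂ) :=
    { carrier := {Y | ∀ c, Y c = ((2 : ℂ)⁻¹ * (Y c).trace) • (1 : Matrix (Fin 2) (Fin 2) ℂ)}
      add_mem' := fun {A B} hA hB c => by
        rw [Pi.add_apply, Matrix.trace_add, mul_add, add_smul, ← hA c, ← hB c]
      zero_mem' := fun c => by simp
      smul_mem' := fun r A hA c => by
        rw [Pi.smul_apply, Matrix.trace_smul, RCLike.real_smul_eq_coe_smul (K := ℂ) r (A c), RCLike.real_smul_eq_coe_smul (K := ℂ) r (A c).trace]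
        conv_lhs => rw [hA c]
        rw [smul_smul, smul_eq_mul, mul_left_comm] }
  have hZ'c : IsClosed (Z' : Set (PBond (F.P n) 0 → Matrix (Fin 2) (Fin 2) ℂ)) := by
    have hset : (Z' : Set (PBond (F.P n) 0 → Matrix (Fin 2) (Fin 2) ℂ)) =
        ⋂ c : PBond (F.P n) 0, (fun Y : PBond (F.P n) 0 → Matrix (Fin 2) (Fin 2) ℂ => Y c) ⁻¹'
          {X | X = ((2 : ℂ)⁻¹ * X.trace) • (1 : Matrix (Fin 2) (Fin 2) ℂ)} := by
      ext Y
      simp only [Set.mem_iInter, Set.mem_preimage, Set.mem_setOf_eq]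
      exact Iff.rfl
    rw [hset]
    refine isClosed_iInter fun c => IsClosed.preimage (continuous_apply c) ?_
    exact isClosed_eq continuous_id
      ((continuous_const.mul ((Matrix.traceLinearMap (Fin 2) ℂ ℂ).continuous_of_finiteDimensional)).smul continuous_const)
  -- the radius of the scalar window `32ℓLᵏt ≤ 1`
  set ℓ : ℝ := ((((F.P K).d + 2) * (F.P K).L : ℕ) : ℝ) with hℓ
  have hℓ0 : 0 < ℓ := by
    rw [hℓ]
    have h1 : 1 ≤ ((F.P K).d + 2) * (F.P K).L := le_trans (Nat.succ_le_of_lt (F.P K).L_pos) (Nat.le_mul_of_pos_left _ (by omega))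
    exact_mod_cast h1
  have hLk : (0 : ℝ) < ((F.P K).L : ℝ) ^ (K - n) := pow_pos (by exact_mod_cast (F.P K).L_pos) _
  set R : ℝ := 32 * ℓ * ((F.P K).L : ℝ) ^ (K - n) with hR
  have hR0 : 0 < R := by positivity
  have hρ : 0 < R⁻¹ := inv_pos.2 hR0
  -- the `1∕8` window at `A₁` (`e ≤ (10⁹L²)⁻¹`)
  have hL0 : (0 : ℝ) < F.L := by
    have hL3 : 3 ≤ F.L := by obtain ⟨a, ha⟩ := F.hL.1; have := F.hL.2; omega
    exact_mod_cast (show 0 < F.L by omega)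
  have hpos : (0 : ℝ) < 10 ^ 9 * (F.L : ℝ) ^ 2 := by positivity
  have hA₁' : ‖A₁‖ < (10 ^ 9 * (F.L : ℝ) ^ 2)⁻¹ * eta F n K := by
    have he' : e ≤ (10 ^ 9 * (F.L : ℝ) ^ 2)⁻¹ := by
      rw [le_inv_comm₀ he hpos]; calc 10 ^ 9 * (F.L : ℝ) ^ 2 = (10 ^ 9 * (F.L : ℝ) ^ 2 * e) * e⁻¹ := by field_simp
        _ ≤ 1 * e⁻¹ := by gcongr
        _ = e⁻¹ := one_mul _
    exact hA₁.trans_le (mul_le_mul_of_nonneg_right he' (eta_pos F n K).le)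
  -- the translated chart sends `Z ∩ B(0, R⁻¹)` into `Z′`
  have hmaps : ∀ y ∈ Z, ‖y‖ < R⁻¹ →
      (fun y : PBond (F.P K) 0 → Matrix (Fin 2) (Fin 2) ℂ => logChartTwS F n K h U₀ (A₁ + y) - logChartTwS F n K h U₀ A₁) y ∈ Z' := by
    intro y hy hyρ c'
    set z : PBond (F.P K) 0 → ℂ := fun b => -Complex.I * ((2 : ℂ)⁻¹ * (y b).trace) with hz
    have hy' : (A₁ + y) = fun b => A₁ b + (Complex.I * z b) • (1 : Matrix (Fin 2) (Fin 2) ℂ) := by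
      funext b
      rw [Pi.add_apply, hy b, hz]
      congr 1
      rw [← mul_assoc, mul_neg, Complex.I_mul_I, neg_neg, one_mul]
    have hzn : ∀ b, ‖z b‖ ≤ ‖y‖ := fun b => by
      have h1 : ‖y b‖ = ‖(2 : ℂ)⁻¹ * (y b).trace‖ := by
        conv_lhs => rw [hy b]
        rw [norm_smul, norm_one, mul_one]
      rw [hz]
      show ‖-Complex.I * ((2 : ℂ)⁻¹ * (y b).trace)‖ ≤ ‖y‖
      rw [norm_mul, norm_neg, Complex.norm_I, one_mul, ← h1]
      exact norm_le_pi_norm y b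
    have hsmall : 32 * ℓ * (((F.P K).L : ℝ) ^ (K - n) * ‖y‖) ≤ 1 := by
      have h1 : R * ‖y‖ ≤ R * R⁻¹ := mul_le_mul_of_nonneg_left hyρ.le hR0.le
      rw [mul_inv_cancel₀ hR0.ne'] at h1
      calc 32 * ℓ * (((F.P K).L : ℝ) ^ (K - n) * ‖y‖) = R * ‖y‖ := by rw [hR]; ring
        _ ≤ 1 := h1
    have hA8 := norm_dbarTwS_sub_one_le_eighth_of_regPr F h hε₀ hWε U₀ hreg hA₁' c'
    have hadd := logChartTwS_add_central F h U₀ A₁ z (norm_nonneg y) hsmall hzn hWl hT c' hA8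
    show (logChartTwS F n K h U₀ (A₁ + y) - logChartTwS F n K h U₀ A₁) c' =
      ((2 : ℂ)⁻¹ * ((logChartTwS F n K h U₀ (A₁ + y) - logChartTwS F n K h U₀ A₁) c').trace) • (1 : Matrix (Fin 2) (Fin 2) ℂ)
    rw [Pi.sub_apply, hy', hadd, add_sub_cancel_left, Matrix.trace_smul, Matrix.trace_one, Fintype.card_fin, smul_eq_mul]
    congr 1
    push_cast
    ring
  have hv : (fun b => s b • (1 : Matrix (Fin 2) (Fin 2) ℂ)) ∈ Z := fun b => by
    show s b • (1 : Matrix (Fin 2) (Fin 2) ℂ) = ((2 : ℂ)⁻¹ * (s b • (1 : Matrix (Fin 2) (Fin 2) ℂ)).trace) • 1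
    rw [Matrix.trace_smul, Matrix.trace_one, Fintype.card_fin, smul_eq_mul]
    congr 1
    push_cast
    ring
  have key := fderiv_apply_mem_of_mapsTo_of_ball (hasFDerivAt_logChartTwS_translate F h hε₀ he hWe hWε U₀ hreg hA₁)
    (by simp) Z Z' hZ'c hρ hmaps hv
  exact key c

end Structure


end Summit.QuantumFields.YangMills.Theorems.Prop7TwistedSliceGaugeOntoSU2

end
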